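import Mathlib.Analysis.SpecificLimits.Normed
import Mathlib.NumberTheory.Padics.PadicIntegers
import Mathlib.Logic.Function.Iterate
import Literature.AnabelianGeometry.AbsoluteAnabelian.LogShells
import HarnessLib

/-!
# [IUTchIII] Remark 1.1.1 (i), Remark 1.2.2 (iii) (iterates of the log-link and "upper semi-commutativity"), Remark 2.1.1 (v), Remark 2.2.2 (i)

Mochizuki, *Inter-universal Teichmüller Theory III*, kurims manuscript (May 2020), §1–§2
(D-0012 claim key, status disputed; every decl carries `[claim: Mochizuki2012, status: disputed]`; the
facts proved are elementary and take no side).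

Printed text.
* Rmk 1.1.1 (i) p.28: "we shall have occasion to consider "iterates" of log-links. The log-links … that
  appear in such iterates are to be understood as being defined only on the [local] units … that appear in
  the domains of these log-links. … when considering the effect of applying various iterates of log-links,
  it suffices … to consider the effect of such iterates on the various groups of local units that appear."
* Rmk 1.2.2 (iii) p.37 (at `v ∈ V̲^{non}`): "the coric holomorphic log-shells of Proposition 1.2, (ix), contain
  not only the images, via the Kummer isomorphisms …, of the various "`O^▷`" …, but also the images, via
  the composite of the Kummer isomorphisms with the various iterates … of the log-link …, of the portions
  of the various "`O^▷`" … on which these iterates are defined. … Thus, although the diagram … `Γ⃗` fails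
  to be commutative, the coric holomorphic log-shells involved exhibit a sort of "upper
  semi-commutativity" with respect to containing/surjecting onto the various images arising from
  composites of arrows in `Γ⃗`."
* Rmk 2.1.1 (v) p.63: "unlike the case with `ℚ` or `ℝ`, there is no notion of positivity [or negativity]
  in `Ẑ`. For instance, `−1 ∈ Ẑ` may be obtained as a limit of positive integers."
* Rmk 2.2.2 (i) p.69: "Can one develop a similar theory … in which one replaces the `Θ^{×μ}_{gau}`-link
  `q ↦ q^{(1², 2², …, (l^⋇)²)}` [cf. [IUTchII], Remark 4.11.1] by a correspondence of the form `q ↦ q^λ` —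
  where `λ` is some arbitrary positive integer?" ("The answer to this question is "no"" — prose, not typed.)

Typed (model: L4-t3's `PadicLogOnUnits K`, [AbsTopIII] Def 5.4 (iii); `O_k^× = sphere 0 1`). `iterDomain
L n` = the portion of the units on which the `n`-th iterate of the log-link is defined (Rmk 1.1.1 (i));
PROVED: `iterate_image_subset_preLogShell` — for every `n ≥ 1` the `n`-th iterate maps its domain INTO
`log_k(O_k^×) = ℐ*` (hence into the log-shell `ℐ` whenever `ℐ* ⊆ ℐ`, Prop 1.2 (v)(c)): the "upper
semi-commutativity" of Rmk 1.2.2 (iii) at the level of the model; `PadicInt.tendsto_pow_sub_one` (Rmk 2.1.1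
(v): `pⁿ − 1 → −1` in `ℤ_p`, so `−1` is a limit of positive integers in each `ℤ_p`, hence in `Ẑ = ∏ ℤ_p`);
`gaussianExponents` / `naiveExponent` (Rmk 2.2.2 (i); the exponent vector `(1², …, (l^⋇)²)` of the
`Θ^{×μ}_{gau}`-link vs the single exponent `λ`). Deliberately NOT typed: the archimedean wording of Rmk 1.2.2
(iii) ("a certain surjectivity"), Rmk 1.2.2 (iv)–(vii) (no "lower semi-commutativity"; Fig. 1.1), the
remainder of Rmk 2.1.1 (v) and Rmk 2.2.2 (i)–(iii) (philosophy).
-/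

noncomputable section

namespace Literature.IUT.LogThetaLattice

open Set Metric Filter Topology
open Literature.AnabelianGeometry.AbsoluteAnabelian

/-! ### Rmk 1.1.1 (i) / Rmk 1.2.2 (iii): iterates of the log-link on the local units -/

section Iterates

variable {K : Type*} [NontriviallyNormedField K] (L : PadicLogOnUnits K)

/-- **IUTchIII:Rmk1.1.1(i)** (kurims p.28) the portion of the local units `O_k^× = {‖x‖ = 1}` on which the
`n`-th iterate of the log-link is defined ("defined only on the [local] units that appear in the domains"):
`D_0 = k`, `D_{n+1} = {x ∈ O_k^× | log_k x ∈ D_n}`. [claim: Mochizuki2012, status: disputed] -/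
def iterDomain : ℕ → Set K
  | 0 => univ
  | n + 1 => {x | x ∈ sphere (0 : K) 1 ∧ L.log x ∈ iterDomain n}

/-- **IUTchIII:Rmk1.1.1(i)** (kurims p.28) `D_0 = k`. [claim: Mochizuki2012, status: disputed] -/
@[simp] theorem iterDomain_zero : iterDomain L 0 = univ := rfl

/-- **IUTchIII:Rmk1.1.1(i)** (kurims p.28) `D_{n+1} = O_k^× ∩ log_k⁻¹(D_n)`. [claim: Mochizuki2012, status: disputed] -/
theorem mem_iterDomain_succ (n : ℕ) (x : K) :
    x ∈ iterDomain L (n + 1) ↔ x ∈ sphere (0 : K) 1 ∧ L.log x ∈ iterDomain L n := Iff.rfl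

/-- **IUTchIII:Rmk1.1.1(i)** (kurims p.28) every iterate (`n ≥ 1`) is defined only on units: `D_{n+1} ⊆ O_k^×`.
[claim: Mochizuki2012, status: disputed] -/
theorem iterDomain_succ_subset_sphere (n : ℕ) : iterDomain L (n + 1) ⊆ sphere (0 : K) 1 :=
  fun _ hx => hx.1

/-- **IUTchIII:Rmk1.1.1(i)** (kurims p.28) `log_k` maps `D_{n+1}` into `D_n` (the iterate is defined).
[claim: Mochizuki2012, status: disputed] -/
theorem mapsTo_log_iterDomain (n : ℕ) : MapsTo L.log (iterDomain L (n + 1)) (iterDomain L n) :=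
  fun _ hx => hx.2

/-- **IUTchIII:Rmk1.1.1(i)** (kurims p.28) the domains decrease: `D_{n+1} ⊆ D_n`. [claim: Mochizuki2012, status: disputed] -/
theorem iterDomain_succ_subset (n : ℕ) : iterDomain L (n + 1) ⊆ iterDomain L n := by
  induction n with
  | zero => exact fun _ _ => mem_univ _
  | succ n ih => exact fun x hx => ⟨hx.1, ih hx.2⟩

/-- **IUTchIII:Rmk1.2.2(iii)** (kurims p.37) the `(n+1)`-st iterate of the log-link sends its domain `D_{n+1}`
into `D_1 = O_k^×`-image: precisely, `log_k^{[n]}(D_{n+1}) ⊆ O_k^×` … [claim: Mochizuki2012, status: disputed] -/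
theorem iterate_mapsTo_sphere (n : ℕ) : MapsTo (L.log^[n]) (iterDomain L (n + 1)) (sphere (0 : K) 1) := by
  induction n with
  | zero => exact fun x hx => hx.1
  | succ n ih =>
    intro x hx
    rw [Function.iterate_succ_apply]
    exact ih (mapsTo_log_iterDomain L (n + 1) hx)

/-- **IUTchIII:Rmk1.2.2(iii)** (kurims p.37) **"upper semi-commutativity"** at the model level: for every
`n ≥ 1`, the image of the `n`-th iterate of the log-link on the portion `D_n` of the units on which it is
defined lies in `log_k(O_k^×) = ℐ*` (L4-t3's `preLogShell`) — so the [coric] log-shell contains the images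
arising from ALL composites of arrows of `Γ⃗`, although `Γ⃗` is not commutative.
[claim: Mochizuki2012, status: disputed] -/
theorem iterate_image_subset_preLogShell (n : ℕ) :
    (L.log^[n + 1]) '' iterDomain L (n + 1) ⊆ preLogShell L := by
  rintro _ ⟨x, hx, rfl⟩
  rw [Function.iterate_succ_apply']
  exact ⟨_, iterate_mapsTo_sphere L n hx, rfl⟩

/-- **IUTchIII:Rmk1.2.2(iii)** (kurims p.37) … hence in the log-shell `ℐ = (p*)⁻¹·ℐ*` as soon as `ℐ* ⊆ ℐ`
(Prop 1.2 (v)(c), `HolomorphicLogShells.preLogShell_subset_logShell`). [claim: Mochizuki2012, status: disputed] -/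
theorem iterate_image_subset_logShell (hc : preLogShell L ⊆ logShell L) (n : ℕ) :
    (L.log^[n + 1]) '' iterDomain L (n + 1) ⊆ logShell L :=
  (iterate_image_subset_preLogShell L n).trans hc

end Iterates

/-! ### Rmk 2.1.1 (v): `−1` is a limit of positive integers in `Ẑ` -/

/-- **IUTchIII:Rmk2.1.1(v)** (kurims p.63) "there is no notion of positivity [or negativity] in `Ẑ`. For
instance, `−1 ∈ Ẑ` may be obtained as a limit of positive integers": in each factor `ℤ_p` of `Ẑ = ∏_p ℤ_p`,
`pⁿ − 1 → −1`. [claim: Mochizuki2012, status: disputed] -/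
theorem PadicInt.tendsto_pow_sub_one (p : ℕ) [Fact p.Prime] :
    Tendsto (fun n : ℕ => ((p ^ n - 1 : ℤ) : ℤ_[p])) atTop (𝓝 (-1)) := by
  have h0 : Tendsto (fun n : ℕ => ((p : ℤ_[p]) ^ n)) atTop (𝓝 0) := by
    apply tendsto_pow_atTop_nhds_zero_of_norm_lt_one
    rw [PadicInt.norm_p]
    exact inv_lt_one_of_one_lt₀ (by exact_mod_cast (Fact.out : p.Prime).one_lt)
  have h1 : Tendsto (fun n : ℕ => ((p : ℤ_[p]) ^ n - 1)) atTop (𝓝 (0 - 1)) := h0.sub_const 1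
  rw [zero_sub] at h1
  convert h1 using 2 with n
  push_cast; ring

/-- **IUTchIII:Rmk2.1.1(v)** (kurims p.63) … and each `pⁿ − 1` (`n ≥ 1`) is a POSITIVE integer.
[claim: Mochizuki2012, status: disputed] -/
theorem pow_sub_one_pos {p : ℕ} (hp : 1 < p) {n : ℕ} (hn : n ≠ 0) : 0 < (p : ℤ) ^ n - 1 := by
  have : 1 < (p : ℤ) ^ n := one_lt_pow₀ (by exact_mod_cast hp) hn
  linarith

/-! ### Rmk 2.2.2 (i): the exponents of the `Θ^{×μ}_{gau}`-link versus a naive `q ↦ q^λ` -/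

/-- **IUTchIII:Rmk2.2.2(i)** (kurims p.69) the exponent vector `(1², 2², …, (l^⋇)²)` of the `Θ^{×μ}_{gau}`-link
`q ↦ (q^{j²})_{j=1,…,l^⋇}` [IUTchII, Rmk 4.11.1], `l^⋇ = (l−1)/2`. [claim: Mochizuki2012, status: disputed] -/
def gaussianExponents (lstar : ℕ) : Fin lstar → ℕ := fun j => (j.val + 1) ^ 2

/-- **IUTchIII:Rmk2.2.2(i)** (kurims p.69) the naive replacement: a single "arbitrary positive integer" `λ`,
`q ↦ q^λ`. [claim: Mochizuki2012, status: disputed] -/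
def naiveExponent (lam : ℕ) : Fin 1 → ℕ := fun _ => lam

/-- **IUTchIII:Rmk2.2.2(i)** (kurims p.69) the first Gaussian exponent is `1 = 1²` and the exponents are
pairwise distinct (strictly increasing in `j`), unlike any constant assignment for `l^⋇ ≥ 2`.
[claim: Mochizuki2012, status: disputed] -/
theorem gaussianExponents_strictMono (lstar : ℕ) : StrictMono (gaussianExponents lstar) := by
  intro i j hij
  unfold gaussianExponents
  have : i.val + 1 < j.val + 1 := by simpa using hij
  exact Nat.pow_lt_pow_left this two_ne_zero

end Literature.IUT.LogThetaLattice
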